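import Literature.AlgebraicGeometry.Resolution.PrincipalizationToResolution
import HarnessLib

/-!
# `ProductDescent` (crux stmt-ResolutionOfSingularities-15231), line `vertical-lines` —
stub `stub_affineInduction`

Helper file (`--supports stmt-ResolutionOfSingularities-15231`; does not close the item).

INDUCTION ON THE NUMBER OF AFFINE VARIABLES. Product descent for opens of `𝔸¹_Y` (all
integral separated finite-type `𝔽_p`-schemes `Y`) implies product descent for opens of `𝔸ˢ_Y`
(all `s`, all `Y`):

* `s = 0`: `𝔸⁰_Y ↘ Y` is an isomorphism, so a resolvable open `W' ∋ w` of `W ⊆ 𝔸⁰_Y` maps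
  isomorphically onto an open of `Y` through the image of `w`.
* `s → s + 1`: there is a `Y`-isomorphism `𝔸ˢ⁺¹_Y ≅ 𝔸¹_{𝔸ˢ_Y}` (`affineInduction_exists_iso`,
  built from `AffineSpace.homOfVector` in both directions and checked with
  `AffineSpace.hom_ext`); `𝔸ˢ_Y` is again integral, separated, locally of finite type and
  quasi-compact over `𝔽_p`, so the case `s = 1` over the base `𝔸ˢ_Y` produces a resolvable open
  `U₁` of `𝔸ˢ_Y` through the image of `w`, and the induction hypothesis applied to
  `U₁ ↪ 𝔸ˢ_Y` (with `W' = ⊤`) produces the required open of `Y`.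
-/

set_option linter.dupNamespace false -- mandated namespace of this single-conjunct summit

noncomputable section

open CategoryTheory CategoryTheory.Limits AlgebraicGeometry Literature.AlgebraicGeometry.Resolution

namespace Summit.ResolutionOfSingularities.ResolutionOfSingularities.Theorems.ProductDescent.VerticalLines

/-- **`𝔸ˢ⁺¹_Y ≅ 𝔸¹_{𝔸ˢ_Y}` over `Y`.** There is an isomorphism `e : 𝔸ˢ⁺¹_Y ⟶ 𝔸¹_{𝔸ˢ_Y}`
compatible with the projections to `Y`: forward, the first `s` coordinates give the map to
`𝔸ˢ_Y` and the last coordinate the extra variable; backward, the `s` coordinates pulled back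
from `𝔸ˢ_Y` followed by the coordinate of `𝔸¹`. [folklore] -/
theorem affineInduction_exists_iso (s : ℕ) (Y : Scheme.{0}) :
    ∃ e : 𝔸(Fin (s + 1); Y) ⟶ 𝔸(Fin 1; 𝔸(Fin s; Y)), IsIso e ∧
      e ≫ (𝔸(Fin 1; 𝔸(Fin s; Y)) ↘ 𝔸(Fin s; Y)) ≫ (𝔸(Fin s; Y) ↘ Y) =
        𝔸(Fin (s + 1); Y) ↘ Y := by
  -- the forward map, characterised by its composite with the projection and its last coordinate
  obtain ⟨fwd, hfwd_over, hfwd_coord⟩ :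
      ∃ fwd : 𝔸(Fin (s + 1); Y) ⟶ 𝔸(Fin 1; 𝔸(Fin s; Y)),
        fwd ≫ (𝔸(Fin 1; 𝔸(Fin s; Y)) ↘ 𝔸(Fin s; Y)) =
          AffineSpace.reindex (Fin.castSucc : Fin s → Fin (s + 1)) Y ∧
        ∀ i : Fin 1, fwd.appTop (AffineSpace.coord 𝔸(Fin s; Y) i) =
          AffineSpace.coord Y (Fin.last s) :=
    ⟨AffineSpace.homOfVector _ _, AffineSpace.homOfVector_over _ _,
      fun i => AffineSpace.homOfVector_appTop_coord _ _ i⟩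
  -- the backward map, characterised by its composite with the projection and its coordinates
  obtain ⟨bwd, hbwd_over, hbwd_castSucc, hbwd_last⟩ :
      ∃ bwd : 𝔸(Fin 1; 𝔸(Fin s; Y)) ⟶ 𝔸(Fin (s + 1); Y),
        bwd ≫ (𝔸(Fin (s + 1); Y) ↘ Y) =
          (𝔸(Fin 1; 𝔸(Fin s; Y)) ↘ 𝔸(Fin s; Y)) ≫ (𝔸(Fin s; Y) ↘ Y) ∧
        (∀ i : Fin s, bwd.appTop (AffineSpace.coord Y (Fin.castSucc i)) =
          (𝔸(Fin 1; 𝔸(Fin s; Y)) ↘ 𝔸(Fin s; Y)).appTop (AffineSpace.coord Y i)) ∧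
        bwd.appTop (AffineSpace.coord Y (Fin.last s)) =
          AffineSpace.coord 𝔸(Fin s; Y) (0 : Fin 1) := by
    refine ⟨AffineSpace.homOfVector _ (Fin.snoc (α := fun _ => Γ(𝔸(Fin 1; 𝔸(Fin s; Y)), ⊤))
      (fun i : Fin s => (𝔸(Fin 1; 𝔸(Fin s; Y)) ↘ 𝔸(Fin s; Y)).appTop (AffineSpace.coord Y i))
      (AffineSpace.coord 𝔸(Fin s; Y) (0 : Fin 1))), AffineSpace.homOfVector_over _ _,
      fun i => ?_, ?_⟩
    · rw [AffineSpace.homOfVector_appTop_coord, Fin.snoc_castSucc]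
    · rw [AffineSpace.homOfVector_appTop_coord, Fin.snoc_last]
  have hcomp : fwd ≫ (𝔸(Fin 1; 𝔸(Fin s; Y)) ↘ 𝔸(Fin s; Y)) ≫ (𝔸(Fin s; Y) ↘ Y) =
      𝔸(Fin (s + 1); Y) ↘ Y := by
    rw [← Category.assoc, hfwd_over, AffineSpace.reindex_over]
  -- `fwd ≫ bwd = 𝟙`
  have h₁ : fwd ≫ bwd = 𝟙 _ := by
    apply AffineSpace.hom_ext
    · rw [Category.assoc, hbwd_over, hcomp, Category.id_comp]
    · intro i
      refine Fin.lastCases ?_ (fun i => ?_) i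
      · simp only [Scheme.Hom.comp_appTop, CommRingCat.comp_apply, hbwd_last, hfwd_coord,
          Scheme.Hom.id_appTop, CommRingCat.id_apply]
      · simp only [Scheme.Hom.comp_appTop, CommRingCat.comp_apply, hbwd_castSucc,
          Scheme.Hom.id_appTop, CommRingCat.id_apply]
        rw [← CommRingCat.comp_apply, ← Scheme.Hom.comp_appTop, hfwd_over,
          AffineSpace.reindex_appTop_coord]
  -- `bwd ≫ fwd = 𝟙`
  have h₂ : bwd ≫ fwd = 𝟙 _ := by
    apply AffineSpace.hom_ext
    · rw [Category.assoc, hfwd_over, Category.id_comp]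
      apply AffineSpace.hom_ext
      · rw [Category.assoc, AffineSpace.reindex_over, hbwd_over]
      · intro i
        simp only [Scheme.Hom.comp_appTop, CommRingCat.comp_apply,
          AffineSpace.reindex_appTop_coord, hbwd_castSucc]
    · intro i
      obtain rfl : i = 0 := Fin.fin_one_eq_zero i
      simp only [Scheme.Hom.comp_appTop, CommRingCat.comp_apply, hfwd_coord, hbwd_last,
        Scheme.Hom.id_appTop, CommRingCat.id_apply]
  exact ⟨fwd, ⟨⟨bwd, h₁, h₂⟩⟩, hcomp⟩

/-- The case `s = 0`: `𝔸⁰_Y ↘ Y` is an isomorphism, so the resolvable open `W' ∋ w` maps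
isomorphically onto an open of `Y` through the image of `w`. [folklore] -/
theorem affineInduction_zero (Y : Scheme.{0}) (W : Scheme.{0}) (j : W ⟶ 𝔸(Fin 0; Y))
    [IsOpenImmersion j] (w : W)
    (hw : ∃ W' : W.Opens, w ∈ W' ∧ Scheme.HasResolution (W' : Scheme.{0})) :
    ∃ U : Y.Opens, (𝔸(Fin 0; Y) ↘ Y).base (j.base w) ∈ U ∧
      Scheme.HasResolution (U : Scheme.{0}) := by
  obtain ⟨W', hw, hres⟩ := hw
  let ι' : (W' : Scheme.{0}) ⟶ Y := W'.ι ≫ j ≫ (𝔸(Fin 0; Y) ↘ Y)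
  haveI : IsOpenImmersion ι' := inferInstanceAs (IsOpenImmersion (W'.ι ≫ j ≫ _))
  refine ⟨ι'.opensRange, ⟨⟨w, hw⟩, ?_⟩, Scheme.HasResolution.of_iso ι'.isoOpensRange.hom hres⟩
  simp [ι']

/-- The induction on `s`, with the base `Y` kept general. [folklore] -/
theorem affineInduction_aux
    (h1 : ∀ p : ℕ, p.Prime → ∀ (Y : Scheme.{0}) (f : Y ⟶ Spec (.of (ZMod p))),
      IsSeparated f → LocallyOfFiniteType f → QuasiCompact f → IsIntegral Y →
      ∀ (W : Scheme.{0}) (j : W ⟶ 𝔸(Fin 1; Y)), IsOpenImmersion j → ∀ w : W,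
      (∃ W' : W.Opens, w ∈ W' ∧ Scheme.HasResolution (W' : Scheme.{0})) →
      ∃ U : Y.Opens, (𝔸(Fin 1; Y) ↘ Y).base (j.base w) ∈ U ∧
        Scheme.HasResolution (U : Scheme.{0}))
    (p : ℕ) (hp : p.Prime) (s : ℕ) :
    ∀ (Y : Scheme.{0}) (f : Y ⟶ Spec (.of (ZMod p))),
      IsSeparated f → LocallyOfFiniteType f → QuasiCompact f → IsIntegral Y →
      ∀ (W : Scheme.{0}) (j : W ⟶ 𝔸(Fin s; Y)), IsOpenImmersion j → ∀ w : W,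
      (∃ W' : W.Opens, w ∈ W' ∧ Scheme.HasResolution (W' : Scheme.{0})) →
      ∃ U : Y.Opens, (𝔸(Fin s; Y) ↘ Y).base (j.base w) ∈ U ∧
        Scheme.HasResolution (U : Scheme.{0}) := by
  induction s with
  | zero =>
    intro Y f _ _ _ _ W j hj w hw
    exact affineInduction_zero Y W j w hw
  | succ s ih =>
    intro Y f hs hl hq hi W j hj w hw
    obtain ⟨e, he, hecomp⟩ := affineInduction_exists_iso s Y
    -- the case `s = 1` over the base `𝔸ˢ_Y`
    obtain ⟨U₁, hU₁, hres₁⟩ := h1 p hp 𝔸(Fin s; Y) ((𝔸(Fin s; Y) ↘ Y) ≫ f) inferInstance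
      inferInstance inferInstance inferInstance W (j ≫ e) inferInstance w hw
    -- the induction hypothesis for the resolvable open `U₁ ↪ 𝔸ˢ_Y`
    obtain ⟨U, hU, hres⟩ := ih Y f hs hl hq hi (U₁ : Scheme.{0}) U₁.ι inferInstance ⟨_, hU₁⟩
      ⟨⊤, trivial, hres₁.restrict ⊤⟩
    refine ⟨U, ?_, hres⟩
    have key : (𝔸(Fin s; Y) ↘ Y).base
        ((𝔸(Fin 1; 𝔸(Fin s; Y)) ↘ 𝔸(Fin s; Y)).base ((j ≫ e).base w)) =
        (𝔸(Fin (s + 1); Y) ↘ Y).base (j.base w) := by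
      rw [← hecomp]
      simp only [Scheme.Hom.comp_base, TopCat.comp_app]
    rw [← key]
    exact hU

/-- **Induction on the number of affine variables.** Product descent for opens of `𝔸¹_Y`
(all `Y`) implies product descent for opens of `𝔸ˢ_Y` (all `s`, all `Y`): write
`𝔸ˢ⁺¹_Y ≅ 𝔸¹_{𝔸ˢ_Y}` over `Y` (`AffineSpace.homOfVector` both ways), apply the case `s = 1` over
the integral separated finite-type `𝔽_p`-scheme `𝔸ˢ_Y` to get a resolvable open of `𝔸ˢ_Y`
through the image of `w`, and conclude by the induction hypothesis applied to that open (with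
`W' = ⊤`); `s = 0` is transport along the isomorphism `𝔸⁰_Y ↘ Y`. [folklore] -/
theorem stub_affineInduction :
    (∀ p : ℕ, p.Prime → ∀ (Y : Scheme.{0}) (f : Y ⟶ Spec (.of (ZMod p))),
      IsSeparated f → LocallyOfFiniteType f → QuasiCompact f → IsIntegral Y →
      ∀ (W : Scheme.{0}) (j : W ⟶ 𝔸(Fin 1; Y)), IsOpenImmersion j → ∀ w : W,
      (∃ W' : W.Opens, w ∈ W' ∧ Scheme.HasResolution (W' : Scheme.{0})) →
      ∃ U : Y.Opens, (𝔸(Fin 1; Y) ↘ Y).base (j.base w) ∈ U ∧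
        Scheme.HasResolution (U : Scheme.{0})) →
    ∀ p : ℕ, p.Prime → ∀ (Y : Scheme.{0}) (f : Y ⟶ Spec (.of (ZMod p))),
      IsSeparated f → LocallyOfFiniteType f → QuasiCompact f → IsIntegral Y →
      ∀ (s : ℕ) (W : Scheme.{0}) (j : W ⟶ 𝔸(Fin s; Y)), IsOpenImmersion j → ∀ w : W,
      (∃ W' : W.Opens, w ∈ W' ∧ Scheme.HasResolution (W' : Scheme.{0})) →
      ∃ U : Y.Opens, (𝔸(Fin s; Y) ↘ Y).base (j.base w) ∈ U ∧
        Scheme.HasResolution (U : Scheme.{0}) :=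
  fun h1 p hp Y f hs hl hq hi s => affineInduction_aux h1 p hp s Y f hs hl hq hi

end Summit.ResolutionOfSingularities.ResolutionOfSingularities.Theorems.ProductDescent.VerticalLines
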